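import Literature.Computability.MetaComplexity.CuttingPlanesInterpolationBits
import HarnessLib

/-!
# Feasible monotone interpolation for cutting planes with small coefficients

Pudlák's interpolation theorem for cutting planes (Pudlák 1997, Thm. 3) in the
polynomially-bounded-coefficient form of Bonet–Pitassi–Raz (1997, §4) and Krajíček (1997, §6):
from a `CP` refutation `π` of `A(x,y) ++ B(x,z)` (clauses of `A` over `x, y`; clauses of `B` over
NEGATED `x` and `z`, `CPSplit.okA` / `CPSplit.okB`) one reads off an interpolant
`I : (X → Bool) → Bool` with `I a = false ⇒ A(a,·)` unsatisfiable and `I a = true ⇒ B(a,·)`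
unsatisfiable, which is constant or computed by a MONOTONE circuit over `{∧₂, ∨₂}` with at most
`8 |π| (W + 3)³` gates, `W = cpNorm π` the `ℓ¹`-norm of the refutation
(`cp_monotone_interpolation`, `cp_monotone_interpolation'`).

The interpolant is the bit `uz ∨ (dz ≥ 1)` of the clamped splitting recursion
(`CuttingPlanesSplit.lean`) at a contradiction line; this file proves that the unary bit layout
of `CuttingPlanesInterpolationBits.lean` computes that recursion
(`CPBits.corr`: flags, the window bits `[dz ≥ t]`, and the interpolant bit of every line), by
strong induction along the derivation: unary counting of the true negated shared variables of a
`B`-axiom (`CPBits.cnt_corr`, `CPBits.xHom_ofClause_eq_neg_count`), unary addition as a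
disjunction over the window, multiplication and rounded division by constants and clamping as
re-indexings of threshold bits.

## References

* P. Pudlák, J. Symbolic Logic 62 (1997), Thm. 3 [Pudlak1997].
* M. Bonet, T. Pitassi, R. Raz, J. Symbolic Logic 62 (1997), §4, §6 [BonetPitassiRaz1997].
* J. Krajíček, J. Symbolic Logic 62 (1997), §6 [Krajicek1997].
-/

namespace Literature.Computability.MetaComplexity

open Finset Literature.Computability.Complexity CPLine MForm CPSplit

namespace CPBits

variable {X Y Z : Type*}

/-! ### Counting the true negated shared variables of a `B`-clause -/

/-- Lengths of filtered `getLeft?`-projections as sums of indicators. [folklore] -/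
theorem length_filter_filterMap_getLeft (p : X → Bool) :
    ∀ l : List (X ⊕ (Y ⊕ Z)), (((l.filterMap Sum.getLeft?).filter fun x => p x).length : ℤ) =
      (l.map fun v => Sum.elim (fun x => if p x = true then (1 : ℤ) else 0) (fun _ => 0) v).sum
  | [] => rfl
  | v :: l => by
    rcases v with x | w
    · rw [List.filterMap_cons_some (by rfl), List.filter_cons, List.map_cons, List.sum_cons,
        ← length_filter_filterMap_getLeft p l]
      by_cases h : p x = true
      · simp [h, add_comm]
      · simp [h]
    · rw [List.filterMap_cons_none (by rfl), List.map_cons, List.sum_cons,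
        length_filter_filterMap_getLeft p l]
      simp

/-- The shared coefficients of a `B`-clause line: `-1` on the negated shared variables of the
clause, `0` elsewhere. [cite: Pudlak1997, Thm. 3 (proof)] -/
theorem coeff_ofClause_inl [DecidableEq X] [DecidableEq Y] [DecidableEq Z] {C : Clause (X ⊕ (Y ⊕ Z))}
    (hC : ∀ l ∈ C, okB l = true) (x : X) :
    (ofClause C).coeff (Sum.inl x) = if (Sum.inl x, false) ∈ C.toFinset then -1 else 0 := by
  unfold ofClause
  simp only [Finsupp.finsetSum_apply]
  have h : ∀ l ∈ C.toFinset, (litCoeff l) (Sum.inl x : X ⊕ (Y ⊕ Z)) =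
      if l = (Sum.inl x, false) then (-1 : ℤ) else 0 := by
    intro l hl
    have hok := hC l (List.mem_toFinset.1 hl)
    obtain ⟨v, b⟩ := l
    unfold litCoeff
    rw [Finsupp.single_apply]
    by_cases hv : v = Sum.inl x
    · subst hv
      have hb : b = false := by simpa [okB] using hok
      subst hb
      simp
    · rw [if_neg hv, if_neg (fun h => hv (Prod.mk.inj h).1)]
  rw [Finset.sum_congr rfl h, Finset.sum_ite_eq']

/-- **The `x`-part of a `B`-clause line counts its true negated shared variables**:
`∑ α a(x) = -#{x listed : a x}`. [cite: Pudlak1997, Thm. 3 (proof)] -/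
theorem xHom_ofClause_eq_neg_count [DecidableEq X] [DecidableEq Y] [DecidableEq Z]
    {C : Clause (X ⊕ (Y ⊕ Z))} (hC : ∀ l ∈ C, okB l = true) (a : X → Bool) :
    xHom a (ofClause C).coeff = -(((xsOf (ofClause C)).filter fun x => a x).length : ℤ) := by
  set f := (ofClause C).coeff with hf
  have h1 : xHom (Y := Y) (Z := Z) a f = f.sum fun v c => Sum.elim (fun x => c * bX a x)
      (Sum.elim (fun _ => (0 : ℤ)) (fun _ => (0 : ℤ))) v := by
    simp only [xHom, Finsupp.liftAddHom_apply]
    refine Finsupp.sum_congr fun v _ => ?_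
    rcases v with x | y | z <;> simp
  rw [h1, Finsupp.sum, ← Finset.sum_map_toList f.support
      (fun v => Sum.elim (fun x => f v * bX a x) (Sum.elim (fun _ => (0 : ℤ)) (fun _ => (0 : ℤ))) v),
    xsOf, length_filter_filterMap_getLeft, ← neg_one_mul, ← List.sum_map_mul_left]
  congr 1
  refine List.map_congr_left fun v hv => ?_
  have hv' : f v ≠ 0 := Finsupp.mem_support_iff.1 (Finset.mem_toList.1 hv)
  rcases v with x | y | z
  · have hx := coeff_ofClause_inl hC x
    rw [← hf] at hx
    rw [hx] at hv'
    simp only [Sum.elim_inl, hx, bX]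
    split_ifs at hv' ⊢ with hmem ha <;> first | exact absurd rfl hv' | simp
  · simp
  · simp

/-! ### The semantic bits of the layout -/

section Corr

variable [DecidableEq X] [DecidableEq Y] [DecidableEq Z]
variable (A : CNF (X ⊕ (Y ⊕ Z))) (π : List (CPStep (X ⊕ (Y ⊕ Z)))) (a : X → Bool)

/-- The semantic bit of slot `s` of the layout (window `W = cpNorm π`). [folklore] -/
noncomputable def β (s : ℕ) : Bool := BlockProg.bit (spec A π (cpNorm π)) a s

/-- The environment seen by slot `S`: earlier bits, later ones read `false`. [folklore] -/
noncomputable def envLt (S : ℕ) : ℕ → Bool := fun s' => if s' < S then β A π a s' else false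

/-- The bit recursion of the layout. [folklore] -/
theorem β_eq (S : ℕ) : β A π a S = (spec A π (cpNorm π) S).eval a (envLt A π a S) :=
  BlockProg.bit_eq _ _ _

/-- An earlier bit is read correctly. [folklore] -/
theorem eval_bit_of_lt {S s : ℕ} (h : s < S) : (MForm.bit s : MForm X).eval a (envLt A π a S) = β A π a s := by
  simp [envLt, h]

/-- The RAW value of line `k` (before clamping). [cite: Pudlak1997, Thm. 3 (proof)] -/
noncomputable def rawZ (k : ℕ) : ℤ := (rawVal A π a k (prevOf A π a k)).1

/-- The OR of the premise flags of line `k`. [cite: Pudlak1997, Thm. 3 (proof)] -/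
noncomputable def rawU (k : ℕ) : Bool := (rawVal A π a k (prevOf A π a k)).2

/-- `dz` is the clamped raw value. [folklore] -/
theorem dz_eq_clamp (k : ℕ) : dz A π a k = CPSplit.clamp (rawZ A π a k) (-Wz π k) (Wz π k) := by
  unfold dz rawZ; rw [dzuz_eq]; rfl

/-- `uz` is a premise flag or overflow. [folklore] -/
theorem uz_eq (k : ℕ) : uz A π a k = (rawU A π a k || decide (Wz π k < rawZ A π a k)) := by
  unfold uz rawU rawZ; rw [dzuz_eq]; rfl

variable {A π a}

/-- **Reading a value reference**: if the window bits of line `i` are correct and precede the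
current slot, `valRef i t` reads `[dz_i ≥ t]` for EVERY integer `t`. [folklore] -/
theorem eval_valRef_eq {S i : ℕ} (hlt : ∀ t : ℤ, -(cpNorm π : ℤ) + 1 ≤ t → t ≤ cpNorm π → valSlot (cpNorm π) i t < S)
    (hcorr : ∀ t : ℤ, -(cpNorm π : ℤ) + 1 ≤ t → t ≤ cpNorm π → β A π a (valSlot (cpNorm π) i t) = decide (t ≤ dz A π a i))
    (t : ℤ) : (valRef (cpNorm π) i t : MForm X).eval a (envLt A π a S) = decide (t ≤ dz A π a i) := by
  have hb := abs_le.1 (abs_dz_le_cpNorm A π a i)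
  unfold valRef
  split_ifs with h1 h2
  · rw [eval_tt]; symm; rw [decide_eq_true_eq]; linarith
  · rw [eval_ff]; symm; rw [decide_eq_false_iff_not]; linarith
  · push Not at h1 h2
    rw [eval_bit_of_lt A π a (hlt t (by linarith) h2)]
    exact hcorr t (by linarith) h2

/-! ### The counters -/

/-- **The counter bits count**: `cnt q r = [r ≤ #{i < q : a (x_i)}]` along the listed shared
variables of line `k`. [cite: BonetPitassiRaz1997, §4] -/
theorem cnt_corr {k : ℕ} (hk : k < π.length) :
    ∀ q, q ≤ cpNorm π → ∀ r, 1 ≤ r → r ≤ cpNorm π →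
      β A π a (cntSlot (cpNorm π) k q r) = decide (r ≤ cntTrue a (xsOf (π[k]'hk).line) q) := by
  intro q
  induction q with
  | zero =>
    intro _ r hr hrW
    rw [β_eq, spec_cntSlot A π _ (Nat.zero_le _) hr hrW]
    unfold cntSpec
    rw [List.getElem?_eq_getElem hk]
    simp only [eval_ff, cntTrue, List.take_zero, List.filter_nil, List.length_nil]
    symm; rw [decide_eq_false_iff_not]; omega
  | succ q ih =>
    intro hq r hr hrW
    have ih' := ih (by omega)
    rw [β_eq, spec_cntSlot A π _ hq hr hrW]
    unfold cntSpec
    rw [List.getElem?_eq_getElem hk]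
    dsimp only
    -- the two references
    have e1 : (cntRef (cpNorm π) k q r : MForm X).eval a (envLt A π a (cntSlot (cpNorm π) k (q + 1) r)) =
        decide (r ≤ cntTrue a (xsOf (π[k]'hk).line) q) := by
      unfold cntRef
      rw [if_neg (by omega), if_neg (by omega), eval_bit_of_lt A π a (cntSlot_lt_cntSlot_succ _ hr hrW hr)]
      exact ih' r hr hrW
    have e2 : (cntRef (cpNorm π) k q (r - 1) : MForm X).eval a (envLt A π a (cntSlot (cpNorm π) k (q + 1) r)) =
        decide (r - 1 ≤ cntTrue a (xsOf (π[k]'hk).line) q) := by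
      unfold cntRef
      split_ifs with h1 h2
      · rw [eval_tt]; symm; rw [decide_eq_true_eq]; omega
      · omega
      · rw [eval_bit_of_lt A π a (cntSlot_lt_cntSlot_succ _ (by omega) (by omega) hr)]
        exact ih' (r - 1) (by omega) (by omega)
    split_ifs with h
    · rw [eval_or, eval_and, e1, e2, eval_input, cntTrue_succ a _ h]
      have hc := cntTrue_le a (xsOf (π[k]'hk).line) q
      cases ha : a ((xsOf (π[k]'hk).line)[q]'h)
      · simp only [Bool.and_false, Bool.or_false, Bool.false_eq_true, ↓reduceIte, Nat.add_zero]
      · simp only [Bool.and_true, ↓reduceIte]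
        by_cases h1 : r ≤ cntTrue a (xsOf (π[k]'hk).line) q
        · simp [h1, h1.trans (Nat.le_succ _)]
        · by_cases h2 : r - 1 ≤ cntTrue a (xsOf (π[k]'hk).line) q
          · have : r ≤ cntTrue a (xsOf (π[k]'hk).line) q + 1 := by omega
            simp [h1, h2, this]
          · have : ¬ r ≤ cntTrue a (xsOf (π[k]'hk).line) q + 1 := by omega
            simp [h1, h2, this]
    · rw [e1, cntTrue_succ_of_le a _ (not_lt.1 h)]

/-! ### The correspondence -/

variable {B : CNF (X ⊕ (Y ⊕ Z))}

/-- `⌈t/c⌉ ≤ e ↔ t ≤ c e` (`c > 0`). [folklore] -/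
theorem ceilDiv_le_iff {t e : ℤ} {c : ℕ} (hc : 0 < c) : ceilDiv t c ≤ e ↔ t ≤ (c : ℤ) * e :=
  ⟨fun h => (le_mul_ceilDiv t hc).trans (mul_le_mul_of_nonneg_left h (by positivity)),
    ceilDiv_le_of_le_mul hc⟩

/-- The shape of the premises' flag and the raw value of line `k`, by rule (from the recursion
`rawVal` with the earlier pairs plugged in). [folklore] -/
theorem rawU_rawZ_add {k : ℕ} (hk : k < π.length) {i j : ℕ} (hr : (π[k]'hk).rule = .add i j)
    (hi : i < k) (hj : j < k) :
    rawU A π a k = (uz A π a i || uz A π a j) ∧ rawZ A π a k = dz A π a i + dz A π a j := by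
  unfold rawU rawZ rawVal uz dz
  rw [List.getElem?_eq_getElem hk]
  simp only [hr, prevOf, if_pos hi, if_pos hj, and_self]

/-- Raw pair of a multiplication line. [folklore] -/
theorem rawU_rawZ_mul {k : ℕ} (hk : k < π.length) {c i : ℕ} (hr : (π[k]'hk).rule = .mul c i) (hi : i < k) :
    rawU A π a k = uz A π a i ∧ rawZ A π a k = (c : ℤ) * dz A π a i := by
  unfold rawU rawZ rawVal uz dz
  rw [List.getElem?_eq_getElem hk]
  simp only [hr, prevOf, if_pos hi, and_self]

/-- Raw pair of a division line. [folklore] -/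
theorem rawU_rawZ_div {k : ℕ} (hk : k < π.length) {c i : ℕ} (hr : (π[k]'hk).rule = .div c i) (hi : i < k) :
    rawU A π a k = uz A π a i ∧ rawZ A π a k = ceilDiv (dz A π a i) c := by
  unfold rawU rawZ rawVal uz dz
  rw [List.getElem?_eq_getElem hk]
  simp only [hr, prevOf, if_pos hi, and_self]

/-- Raw pair of a lower-bound line. [folklore] -/
theorem rawU_rawZ_lower {k : ℕ} (hk : k < π.length) {v : X ⊕ (Y ⊕ Z)} (hr : (π[k]'hk).rule = .lower v) :
    rawU A π a k = false ∧ rawZ A π a k =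
      Sum.elim (fun _ => (0 : ℤ)) (Sum.elim (fun _ => 0) (fun _ => (π[k]'hk).line.const)) v := by
  unfold rawU rawZ rawVal
  rw [List.getElem?_eq_getElem hk]
  simp only [hr, and_self]

/-- Raw pair of an upper-bound line. [folklore] -/
theorem rawU_rawZ_upper {k : ℕ} (hk : k < π.length) {v : X ⊕ (Y ⊕ Z)} (hr : (π[k]'hk).rule = .upper v) :
    rawU A π a k = false ∧ rawZ A π a k =
      Sum.elim (fun _ => (0 : ℤ)) (Sum.elim (fun _ => 0) (fun _ => (π[k]'hk).line.const)) v := by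
  unfold rawU rawZ rawVal
  rw [List.getElem?_eq_getElem hk]
  simp only [hr, and_self]

open Classical in
/-- Raw pair of an initial line. [folklore] -/
theorem rawU_rawZ_initial {k : ℕ} (hk : k < π.length) (hr : (π[k]'hk).rule = .initial) :
    rawU A π a k = false ∧ rawZ A π a k =
      if ∃ C ∈ A, (π[k]'hk).line = ofClause C then 0
      else (π[k]'hk).line.const - xHom a (π[k]'hk).line.coeff := by
  unfold rawU rawZ rawVal
  rw [List.getElem?_eq_getElem hk]
  simp only [hr]
  split_ifs <;> exact ⟨rfl, rfl⟩

/-- The premise-flag formula reads the OR of the premises' flags. [folklore] -/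
theorem eval_premFlags {k : ℕ} (hk : k < π.length) (hval : IsValidCPStep (A ++ B) (π.take k) (π[k]'hk))
    (ihF : ∀ i < k, β A π a (flagSlot (cpNorm π) i) = uz A π a i) {S : ℕ} (hS : ∀ i < k, flagSlot (cpNorm π) i < S) :
    (premFlags π (cpNorm π) k : MForm X).eval a (envLt A π a S) = rawU A π a k := by
  have htk : (π.take k).length = k := by simp; omega
  unfold premFlags
  rw [List.getElem?_eq_getElem hk]
  dsimp only
  unfold IsValidCPStep at hval
  rcases hr : (π[k]'hk).rule with _ | v | v | ⟨i, j⟩ | ⟨c, i⟩ | ⟨c, i⟩ <;> rw [hr] at hval <;> dsimp only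
  · rw [eval_ff, (rawU_rawZ_initial (A := A) (a := a) hk hr).1]
  · rw [eval_ff, (rawU_rawZ_lower (A := A) (a := a) hk hr).1]
  · rw [eval_ff, (rawU_rawZ_upper (A := A) (a := a) hk hr).1]
  · obtain ⟨hi, hj, -⟩ := hval
    rw [htk] at hi hj
    rw [eval_or, flagRef, flagRef, eval_bit_of_lt A π a (hS i hi), eval_bit_of_lt A π a (hS j hj), ihF i hi,
      ihF j hj, (rawU_rawZ_add hk hr hi hj).1]
  · obtain ⟨hi, -⟩ := hval
    rw [htk] at hi
    rw [flagRef, eval_bit_of_lt A π a (hS i hi), ihF i hi, (rawU_rawZ_mul hk hr hi).1]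
  · obtain ⟨hi, -⟩ := hval
    rw [htk] at hi
    rw [flagRef, eval_bit_of_lt A π a (hS i hi), ihF i hi, (rawU_rawZ_div hk hr hi).1]

/-- **The raw bits are the thresholds of the raw value** (when no premise flag is raised).
[cite: BonetPitassiRaz1997, §4] -/
theorem raw_corr (hB : ∀ C ∈ B, ∀ l ∈ C, okB l = true)
    {k : ℕ} (hk : k < π.length) (hval : IsValidCPStep (A ++ B) (π.take k) (π[k]'hk))
    (ihV : ∀ i < k, uz A π a i = false → ∀ t : ℤ, -(cpNorm π : ℤ) + 1 ≤ t → t ≤ cpNorm π →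
      β A π a (valSlot (cpNorm π) i t) = decide (t ≤ dz A π a i))
    (hU : rawU A π a k = false) (t : ℤ) (ht : -(cpNorm π : ℤ) + 1 ≤ t) (ht' : t ≤ cpNorm π + 1) :
    β A π a (rawSlot (cpNorm π) k t) = decide (t ≤ rawZ A π a k) := by
  classical
  have htk : (π.take k).length = k := by simp; omega
  set W := cpNorm π with hW
  rw [β_eq, spec_rawSlot A π W ht ht']
  unfold rawSpec
  rw [List.getElem?_eq_getElem hk]
  dsimp only
  unfold IsValidCPStep at hval
  rcases hr : (π[k]'hk).rule with _ | v | v | ⟨i, j⟩ | ⟨c, i⟩ | ⟨c, i⟩ <;> rw [hr] at hval <;> dsimp only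
  · -- initial
    obtain ⟨hU0, hZ⟩ := rawU_rawZ_initial (A := A) (a := a) hk hr
    obtain ⟨C, hC, hL⟩ := hval
    by_cases hex : ∃ C ∈ A, (π[k]'hk).line = ofClause C
    · rw [if_pos hex] at hZ ⊢
      rw [eval_ofBool, hZ]
    · rw [if_neg hex] at hZ ⊢
      have hCB : C ∈ B := by
        rcases List.mem_append.1 hC with hC | hC
        · exact absurd ⟨C, hC, hL⟩ hex
        · exact hC
      -- the count
      set xs := xsOf (π[k]'hk).line with hxs
      set N : ℕ := (xs.filter fun x => a x).length with hN
      have hx : xHom a (π[k]'hk).line.coeff = -(N : ℤ) := by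
        rw [hN, hxs, hL]; exact xHom_ofClause_eq_neg_count (hB C hCB) a
      have hNp : N ≤ xs.length := List.length_filter_le _ _
      have hpW : xs.length ≤ W := (length_xsOf_le_norm _).trans (norm_le_cpNorm (List.getElem_mem hk))
      rw [hZ, hx, sub_neg_eq_add]
      split_ifs with h1 h2
      · rw [eval_tt]; symm; rw [decide_eq_true_eq]; omega
      · rw [eval_ff]; symm; rw [decide_eq_false_iff_not]; omega
      · push Not at h1 h2
        unfold cntRef
        have hr1 : 1 ≤ (t - (π[k]'hk).line.const).toNat := by omega
        have hrW : (t - (π[k]'hk).line.const).toNat ≤ W := by omega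
        rw [if_neg (by omega), if_neg (by omega),
          eval_bit_of_lt A π a (cntSlot_lt_rawSlot W le_rfl hr1 hrW t),
          cnt_corr hk W le_rfl _ hr1 hrW, cntTrue_of_length_le a _ hpW]
        rw [← hN]
        by_cases hle : t ≤ (π[k]'hk).line.const + N
        · rw [decide_eq_true hle, decide_eq_true (by omega)]
        · rw [decide_eq_false hle, decide_eq_false (by omega)]
  · -- lower
    rw [eval_ofBool, (rawU_rawZ_lower (A := A) (a := a) hk hr).2]
  · -- upper
    rw [eval_ofBool, (rawU_rawZ_upper (A := A) (a := a) hk hr).2]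
  · -- addition: unary sum over the window
    obtain ⟨hi, hj, -⟩ := hval
    rw [htk] at hi hj
    obtain ⟨hUk, hZk⟩ := rawU_rawZ_add (A := A) (a := a) hk hr hi hj
    rw [hUk, Bool.or_eq_false_iff] at hU
    have hvi : ∀ s : ℤ, (valRef W i s : MForm X).eval a (envLt A π a (rawSlot W k t)) = decide (s ≤ dz A π a i) :=
      eval_valRef_eq (fun s _ hs => valSlot_lt W hs k hi _) (ihV i hi hU.1)
    have hvj : ∀ s : ℤ, (valRef W j s : MForm X).eval a (envLt A π a (rawSlot W k t)) = decide (s ≤ dz A π a j) :=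
      eval_valRef_eq (fun s _ hs => valSlot_lt W hs k hj _) (ihV j hj hU.2)
    rw [hZk, eval_disj, List.any_map]
    have hbi := abs_le.1 (abs_dz_le_cpNorm A π a i)
    by_cases hle : t ≤ dz A π a i + dz A π a j
    · rw [decide_eq_true hle, List.any_eq_true]
      refine ⟨(dz A π a i + W).toNat, List.mem_range.2 (by omega), ?_⟩
      simp only [Function.comp_apply, eval_and, hvi, hvj, Bool.and_eq_true, decide_eq_true_eq]
      constructor <;> omega
    · rw [decide_eq_false hle, List.any_eq_false]
      intro n _
      simp only [Function.comp_apply, eval_and, hvi, hvj, Bool.and_eq_true, decide_eq_true_eq, not_and]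
      intro h1 h2
      exact hle (by linarith)
  · -- multiplication
    obtain ⟨hi, -⟩ := hval
    rw [htk] at hi
    obtain ⟨hUk, hZk⟩ := rawU_rawZ_mul (A := A) (a := a) hk hr hi
    rw [hUk] at hU
    rw [hZk]
    split_ifs with hc
    · subst hc; simp
    · rw [eval_valRef_eq (S := rawSlot W k t) (fun s _ hs => valSlot_lt W hs k hi _) (ihV i hi hU),
        ← decide_eq_decide.2 (ceilDiv_le_iff (Nat.pos_of_ne_zero hc))]
  · -- division
    obtain ⟨hi, hc, -, -⟩ := hval
    rw [htk] at hi
    obtain ⟨hUk, hZk⟩ := rawU_rawZ_div (A := A) (a := a) hk hr hi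
    rw [hUk] at hU
    rw [hZk, eval_valRef_eq (S := rawSlot W k t) (fun s _ hs => valSlot_lt W hs k hi _) (ihV i hi hU),
      decide_eq_decide.2 (le_ceilDiv_iff hc).symm]

/-- **The correspondence**: along a derivation, the flag slot of every line carries `uz`, the
window value slots carry `[dz ≥ t]` (when the flag is down), and the interpolant slot carries
`uz ∨ (dz ≥ 1)`. [cite: BonetPitassiRaz1997, §4] -/
theorem corr (hB : ∀ C ∈ B, ∀ l ∈ C, okB l = true)
    (hπ : IsCPDerivation (A ++ B) π) (k : ℕ) (hk : k < π.length) :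
    β A π a (flagSlot (cpNorm π) k) = uz A π a k ∧
    (uz A π a k = false → ∀ t : ℤ, -(cpNorm π : ℤ) + 1 ≤ t → t ≤ cpNorm π →
      β A π a (valSlot (cpNorm π) k t) = decide (t ≤ dz A π a k)) ∧
    β A π a (outSlot (cpNorm π) k) = interpAt A π a k := by
  set W := cpNorm π with hW
  induction k using Nat.strong_induction_on with
  | _ k ih =>
    have hval := hπ k hk
    have ihF : ∀ i < k, β A π a (flagSlot W i) = uz A π a i := fun i hi => (ih i hi (hi.trans hk)).1
    have ihV : ∀ i < k, uz A π a i = false → ∀ t : ℤ, -(W : ℤ) + 1 ≤ t → t ≤ W →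
        β A π a (valSlot W i t) = decide (t ≤ dz A π a i) := fun i hi => (ih i hi (hi.trans hk)).2.1
    have hWz0 := Wz_nonneg π k
    have hWzW := Wz_le_cpNorm π k
    -- raw bits
    have hraw : rawU A π a k = false → ∀ t : ℤ, -(W : ℤ) + 1 ≤ t → t ≤ W + 1 →
        β A π a (rawSlot W k t) = decide (t ≤ rawZ A π a k) := raw_corr hB hk hval ihV
    -- flag
    have hflag : β A π a (flagSlot W k) = uz A π a k := by
      rw [β_eq, spec_flagSlot A π W k, flagSpec, eval_or,
        eval_premFlags (S := flagSlot W k) hk hval ihF (fun i hi => flagSlot_lt W k hi _), rawRef,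
        eval_bit_of_lt A π a (rawSlot_lt_flagSlot W (by omega)), uz_eq]
      cases hU : rawU A π a k
      · rw [hraw hU (Wz π k + 1) (by omega) (by omega), Bool.false_or, Bool.false_or]
        by_cases h : Wz π k < rawZ A π a k
        · rw [decide_eq_true h, decide_eq_true (by omega)]
        · rw [decide_eq_false h, decide_eq_false (by omega)]
      · rw [Bool.true_or, Bool.true_or]
    -- window bits
    have hvalb : uz A π a k = false → ∀ t : ℤ, -(W : ℤ) + 1 ≤ t → t ≤ W →
        β A π a (valSlot W k t) = decide (t ≤ dz A π a k) := by
      intro hu t ht ht'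
      rw [uz_eq, Bool.or_eq_false_iff, decide_eq_false_iff_not, not_lt] at hu
      rw [β_eq, spec_valSlot A π W ht ht', valSpec, dz_eq_clamp]
      split_ifs with h1 h2
      · rw [eval_tt]; symm; rw [decide_eq_true_eq]
        exact h1.trans (lo_le_clamp _ _ _)
      · rw [eval_ff]; symm; rw [decide_eq_false_iff_not, not_le]
        exact (clamp_le_hi (by omega)).trans_lt h2
      · push Not at h1 h2
        rw [rawRef, eval_bit_of_lt A π a (rawSlot_lt_valSlot W (by omega) ht), hraw hu.1 t ht (by omega)]
        unfold CPSplit.clamp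
        rw [min_eq_left hu.2]
        by_cases h : t ≤ rawZ A π a k
        · rw [decide_eq_true h, decide_eq_true (h.trans (le_max_right _ _))]
        · rw [decide_eq_false h, decide_eq_false (by rw [not_le, max_lt_iff]; exact ⟨h1, not_le.1 h⟩)]
    refine ⟨hflag, hvalb, ?_⟩
    -- interpolant bit
    rw [β_eq, spec_outSlot A π W k, outSpec, eval_or, flagRef, eval_bit_of_lt A π a (flagSlot_lt_outSlot W k),
      hflag, interpAt]
    cases hu : uz A π a k
    · rw [Bool.false_or, Bool.false_or]
      unfold valRef
      split_ifs with h1 h2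
      · exfalso; omega
      · -- `W = 0`: the window is `{0}`
        rw [eval_ff]; symm; rw [decide_eq_false_iff_not, not_le]
        have := dz_le_Wz A π a k
        omega
      · push Not at h1 h2
        rw [eval_bit_of_lt A π a (valSlot_lt_outSlot W h2), hvalb hu 1 (by omega) h2]
    · rw [Bool.true_or, Bool.true_or]

end Corr

/-- `U W ≤ (W + 3)²` and `8 W + 6 ≤ 8 (W + 3)`: the size bound `8 |π| (W + 3)³`. [folklore] -/
theorem size_bound (n W : ℕ) : n * U W * (8 * W + 6) ≤ 8 * n * (W + 3) ^ 3 := by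
  have h1 : U W ≤ (W + 3) ^ 2 := by unfold U nC; nlinarith
  have h2 : 8 * W + 6 ≤ 8 * (W + 3) := by omega
  calc n * U W * (8 * W + 6) ≤ n * (W + 3) ^ 2 * (8 * (W + 3)) :=
        Nat.mul_le_mul (Nat.mul_le_mul_left _ h1) h2
    _ = 8 * n * (W + 3) ^ 3 := by ring

end CPBits

/-! ### The theorem -/

section Main

open CPBits

variable {X Y Z : Type*} [DecidableEq X] [DecidableEq Y] [DecidableEq Z]

/-- **Feasible monotone interpolation for cutting planes with small coefficients**
(Pudlák 1997, Thm. 3; Bonet–Pitassi–Raz 1997, §6; Krajíček 1997). Let `A(x, y)` and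
`B(x, z)` be CNFs over `X ⊕ (Y ⊕ Z)`, the clauses of `A` containing only `x`- and `y`-literals and
the clauses of `B` only NEGATIVE `x`-literals and `z`-literals, and let `π` be a cutting planes
refutation of `A ++ B` of norm `W = cpNorm π` (all lines `∑ aᵥ xᵥ ≥ b` have `|b| + ∑ |aᵥ| ≤ W`).
Then there is an interpolant `I : (X → Bool) → Bool` — `I a = false ⇒ A(a,·)` unsatisfiable,
`I a = true ⇒ B(a,·)` unsatisfiable — which is constant or computed by a circuit over the
monotone basis `{∧₂, ∨₂}` with at most `8 |π| (W + 3)³` gates.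
[cite: Pudlak1997, Thm. 3] [cite: BonetPitassiRaz1997, §6] -/
theorem cp_monotone_interpolation (A B : CNF (X ⊕ (Y ⊕ Z))) (hA : ∀ C ∈ A, ∀ l ∈ C, okA l = true)
    (hB : ∀ C ∈ B, ∀ l ∈ C, okB l = true) {π : List (CPStep (X ⊕ (Y ⊕ Z)))}
    (hπ : IsCPRefutation (A ++ B) π) :
    ∃ I : (X → Bool) → Bool,
      (∀ a, I a = false → ¬ SatOver A a) ∧ (∀ a, I a = true → ¬ SatOver B a) ∧
      ((∃ b, ∀ a, I a = b) ∨
        ∃ C : Circuit X, C.IsOver monotoneBasis ∧ C.size ≤ 8 * π.length * (cpNorm π + 3) ^ 3 ∧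
          C.Computes I) := by
  classical
  obtain ⟨hder, s, hs, hcon⟩ := hπ
  -- a contradiction line
  set e := π.findIdx fun s => decide (s.line.IsContradiction) with he
  have hex : ∃ s ∈ π, (fun s : CPStep (X ⊕ (Y ⊕ Z)) => decide (s.line.IsContradiction)) s = true :=
    ⟨s, hs, by simp [hcon]⟩
  have helt : e < π.length := List.findIdx_lt_length_of_exists hex
  have hcone : (π[e]'helt).line.IsContradiction := by
    have := List.findIdx_getElem (w := helt)
    simpa using this
  refine ⟨fun a => interpAt A π a e, fun a h => (interp_correct a hA hB hder helt hcone).2 h,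
    fun a h => (interp_correct a hA hB hder helt hcone).1 h, ?_⟩
  -- the circuit
  set W := cpNorm π with hW
  have hP : 1 ≤ 8 * W + 6 := by omega
  have hsz : ∀ s' < π.length * U W, (spec A π W s' : MForm X).size + 1 ≤ 8 * W + 6 :=
    fun s' _ => size_spec_succ_le A π W s'
  have hout : outSlot W e < π.length * U W := by
    unfold outSlot
    exact (slot_lt_of_lt W helt (u' := 0) (by unfold offOut U; omega)).trans_eq (Nat.add_zero _)
  rcases BlockProg.const_or_exists_circuit (8 * W + 6) (spec A π W) hP hsz hout with ⟨b, hb⟩ | ⟨C, hC, hCs, hCe⟩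
  · refine Or.inl ⟨b, fun a => ?_⟩
    show interpAt A π a e = b
    rw [← hb a]
    exact ((corr (a := a) hB hder e helt).2.2).symm
  · refine Or.inr ⟨C, hC, hCs.trans (size_bound _ _), fun a => ?_⟩
    show C.eval a = interpAt A π a e
    rw [hCe a]
    exact (corr (a := a) hB hder e helt).2.2

/-- **Feasible monotone interpolation for cutting planes, circuit form**: if moreover `A(a₀,·)`
and `B(a₁,·)` are satisfiable for some `a₀, a₁`, the interpolant is a MONOTONE Boolean function
computed by a circuit over `{∧₂, ∨₂}` with at most `8 |π| (cpNorm π + 3)³` gates; so a lower bound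
`S` for monotone circuits separating `{a | A(a,·) sat}` from `{a | B(a,·) sat}` forces
`|π| (cpNorm π + 3)³ ≥ S / 8` — exponential size for refutations with polynomially bounded
coefficients. [cite: Pudlak1997, Thm. 3] [cite: BonetPitassiRaz1997, §6] -/
theorem cp_monotone_interpolation' (A B : CNF (X ⊕ (Y ⊕ Z))) (hA : ∀ C ∈ A, ∀ l ∈ C, okA l = true)
    (hB : ∀ C ∈ B, ∀ l ∈ C, okB l = true) {a₀ a₁ : X → Bool} (hA₀ : SatOver A a₀) (hB₁ : SatOver B a₁)
    {π : List (CPStep (X ⊕ (Y ⊕ Z)))} (hπ : IsCPRefutation (A ++ B) π) :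
    ∃ I : (X → Bool) → Bool, Monotone I ∧
      (∀ a, SatOver A a → I a = true) ∧ (∀ a, SatOver B a → I a = false) ∧
      ∃ C : Circuit X, C.IsOver monotoneBasis ∧ C.size ≤ 8 * π.length * (cpNorm π + 3) ^ 3 ∧ C.Computes I := by
  obtain ⟨I, hIA, hIB, h⟩ := cp_monotone_interpolation A B hA hB hπ
  have hIA' : ∀ a, SatOver A a → I a = true := fun a ha => by
    cases hI : I a
    · exact absurd ha (hIA a hI)
    · rfl
  have hIB' : ∀ a, SatOver B a → I a = false := fun a hb => by
    cases hI : I a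
    · rfl
    · exact absurd hb (hIB a hI)
  rcases h with ⟨b, hb⟩ | ⟨C, hC, hs, hCe⟩
  · exfalso
    have h0 := hIA' a₀ hA₀
    have h1 := hIB' a₁ hB₁
    rw [hb] at h0 h1
    rw [h0] at h1
    exact Bool.noConfusion h1
  · refine ⟨I, ?_, hIA', hIB', C, hC, hs, hCe⟩
    have hm := C.monotone_eval_of_isOver_monotoneBasis hC
    intro u v huv
    have := hm huv
    rwa [hCe u, hCe v] at this

end Main

end Literature.Computability.MetaComplexity
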